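import Summits.Ventures.HSemireg.WedgeHankelRecurrenceGaussLobattoGolubNodes

/-!
# Venture HSemireg — **TURÁN DETERMINANTS OF A THREE-TERM RECURRENCE**: for `q_0 = 1`, `q_1 = X − a_0`, `q_{n+2} = (X − a_{n+1}) q_{n+1} − b_{n+1} q_n` the Turán determinants
# `D_n = q_n² − q_{n+1} q_{n−1}` obey `D_1 = b_1 + (a_1 − a_0)(X − a_0)` and `D_{n+1} = b_n D_n + (b_{n+1} − b_n) q_n² + (a_{n+1} − a_n) q_{n+1} q_n`; hence for a CONSTANT diagonal the
# explicit expansion `D_n = b_1 (b_1⋯b_{n−1}) + Σ_{1 ≤ k < n} (b_{k+1} − b_k)(b_{k+1}⋯b_{n−1}) q_k²`, and for constant diagonal and NON-DECREASING positive couplings TURÁN'S INEQUALITY in the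
# quantitative form `D_n(x) ≥ b_1 · (b_1⋯b_{n−1}) > 0` for every real `x`; calibrations: `U_n² − U_{n+1} U_{n−1} = 1` (Chebyshev, second kind) and `He_n² − He_{n+1} He_{n−1} ≥ (n−1)!` (Hermite)

HONEST FRAMING. Part of the Lean index of the computation cell `pub-hsemireg` (seat p10 gen 46, Sunday typer «UNIFORM-IN-n»).  Real polynomials and finite sums only; no variety, no cohomology
theory, no sheaf, no Ext group and no semiregularity map is constructed here; nothing here says that HC / HC_CM / HC_AV holds; no Literature fact (unproved `Prop`) is declared or used.  Custodian
versions as in `WedgeHankelSiegelIdeal` (1/3).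
SOURCES (cited).  P. Turán, *On the zeros of the polynomials of Legendre*, Časopis Pěst. Mat. Fys. 75 (1950) 113–122; G. Szegő, *On an inequality of P. Turán concerning Legendre polynomials*,
Bull. Amer. Math. Soc. 54 (1948) 401–405 (§3: Hermite, Laguerre, ultraspherical); H. Skovgaard, *On inequalities of the Turán type*, Math. Scand. 2 (1954) 65–73; A. E. Danese, *Explicit
evaluations of Turán expressions*, Ann. Mat. Pura Appl. (4) 38 (1955) 339–348 (expansions of `D_n` as positive combinations of squares); G. Szegő, *Orthogonal Polynomials*, (1.12.3), §5.5.
PROOF TYPED HERE.  `D_{n+2} − [b_{n+1} D_{n+1} + (b_{n+2} − b_{n+1}) q_{n+1}² + (a_{n+2} − a_{n+1}) q_{n+2} q_{n+1}] = q_{n+2} · (q_{n+2} − (X − a_{n+1}) q_{n+1} + b_{n+1} q_n) = 0` after expanding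
`q_{n+3}` once; the expansion and the inequality by induction (`b_{n+1} D_{n+1} ≥ b_{n+1} · b_1 (b_1⋯b_n)`, the other two terms `≥ 0` resp. `= 0`); the calibrations through N360
`chebyshevU_recurrence_eq_U` and N359 `hermite_real_recurrence`.
DEDUP DISCLOSURE (`rg -n -i 'turan|turán|cassini' Summits/Ventures/HSemireg Literature`, 2026-09-03): nothing on Turán determinants; Mathlib's `Polynomial.Chebyshev.S_sq_add_S_sq`
(`S_n² + S_{n+1}² − X S_n S_{n+1} = 1`) is the Cassini identity for the rescaled `S = U(X∕2)`, equivalent to `chebyshevU_turan` below but not stated for `U`; `Summit.Ventures.HodgeRepro2…turan_inequality` (T5SU11LegendreSummaryIII) is Turán's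
original LEGENDRE inequality on `[−1, 1]` — a different family and regime (hence the suffix `_recurrence` here).  The 7 names below: 0 hits tree-wide.

WHAT IS IN THE TREE.  N360 `chebyshevU_recurrence_eq_U`, `recurrence_of_coefficients`; N359 `hermite_real_recurrence`; Mathlib `Finset.prod_Ico_id_eq_factorial`.
THIS FILE (namespace `Summit.Ventures.HSemireg.Wedge.HankelOuter` continued; CHAINED on N370 (import only); 0 definitions):
* §1136 `turan_det_one` (`D_1`), **`turan_det_succ`** (the recurrence of the Turán determinants), **`turan_det_expansion`** (constant diagonal: `D_n` as `b_1 (b_1⋯b_{n−1})` plus a combination of the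
  `q_k²` with coefficients `(b_{k+1} − b_k) b_{k+1}⋯b_{n−1}`), `turan_det_const` (constant diagonal and couplings: `D_n = b_1^n`), **`turan_inequality_recurrence`** (constant diagonal, `0 < b_n ≤ b_{n+1}`:
  `b_1 · b_1⋯b_{n−1} ≤ D_n(x)`), `chebyshevU_turan` (`U_{n+1}² − U_{n+2} U_n = 1`), `hermite_turan` (`n! ≤ (He_{n+1}² − He_{n+2} He_n)(x)`).
CAVEATS.  The inequality is the constant-diagonal ∕ monotone-coupling case only (Hermite, Chebyshev-U, Charlier-free); Legendre ∕ ultraspherical Turán inequalities (couplings DEcreasing to `1∕4`,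
valid on `[−1, 1]` only) are NOT covered.  Nothing Ext-side.  New names only.
-/

open Module Polynomial
open scoped Matrix Polynomial

namespace Summit.Ventures.HSemireg.Wedge.HankelOuter

/-! ## §1136. Turán determinants -/

/-- **`D_1 = q_1² − q_2 q_0 = b_1 + (a_1 − a_0)(X − a_0)`.** [this file, §1136] -/
theorem turan_det_one {q : ℕ → ℝ[X]} {a b : ℕ → ℝ} (hq0 : q 0 = 1) (hq1 : q 1 = Polynomial.X - C (a 0))
    (hrec : ∀ n, q (n + 2) = (Polynomial.X - C (a (n + 1))) * q (n + 1) - C (b (n + 1)) * q n) :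
    q 1 ^ 2 - q 2 * q 0 = C (b 1) + C (a 1 - a 0) * (Polynomial.X - C (a 0)) := by
  rw [hrec 0, hq1, hq0, map_sub]
  ring

/-- **THE RECURRENCE OF THE TURÁN DETERMINANTS: `D_{n+2} = b_{n+1} D_{n+1} + (b_{n+2} − b_{n+1}) q_{n+1}² + (a_{n+2} − a_{n+1}) q_{n+2} q_{n+1}`** where `D_m = q_m² − q_{m+1} q_{m−1}`.
[Danese 1955; this file, §1136] -/
theorem turan_det_succ {q : ℕ → ℝ[X]} {a b : ℕ → ℝ}
    (hrec : ∀ n, q (n + 2) = (Polynomial.X - C (a (n + 1))) * q (n + 1) - C (b (n + 1)) * q n) (n : ℕ) :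
    q (n + 2) ^ 2 - q (n + 3) * q (n + 1) =
      C (b (n + 1)) * (q (n + 1) ^ 2 - q (n + 2) * q n) + C (b (n + 2) - b (n + 1)) * q (n + 1) ^ 2 + C (a (n + 2) - a (n + 1)) * (q (n + 2) * q (n + 1)) := by
  rw [show n + 3 = (n + 1) + 2 by ring, hrec (n + 1), map_sub, map_sub]
  linear_combination (q (n + 2)) * hrec n

/-- **EXPANSION FOR A CONSTANT DIAGONAL: `D_{n+1} = b_1 (b_1⋯b_n) + Σ_{k=1}^{n} (b_{k+1} − b_k)(b_{k+1}⋯b_n) q_k²`** (a non-negative combination of squares when `b` is non-decreasing).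
[Danese 1955; this file, §1136] -/
theorem turan_det_expansion {q : ℕ → ℝ[X]} {a b : ℕ → ℝ} (hq0 : q 0 = 1) (hq1 : q 1 = Polynomial.X - C (a 0))
    (hrec : ∀ n, q (n + 2) = (Polynomial.X - C (a (n + 1))) * q (n + 1) - C (b (n + 1)) * q n) (ha : ∀ n, a n = a 0) (n : ℕ) :
    q (n + 1) ^ 2 - q (n + 2) * q n =
      C (b 1 * ∏ j ∈ Finset.Ico 1 (n + 1), b j) + ∑ k ∈ Finset.Ico 1 (n + 1), C ((b (k + 1) - b k) * ∏ j ∈ Finset.Ico (k + 1) (n + 1), b j) * q k ^ 2 := by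
  induction n with
  | zero => rw [zero_add, turan_det_one hq0 hq1 hrec, ha 1, sub_self, C_0, zero_mul, add_zero, Finset.Ico_self, Finset.prod_empty, Finset.sum_empty, add_zero, mul_one]
  | succ n ih =>
    have h1 : 1 ≤ n + 1 := by omega
    have e2 : ∑ k ∈ Finset.Ico 1 (n + 1), C ((b (k + 1) - b k) * ∏ j ∈ Finset.Ico (k + 1) (n + 2), b j) * q k ^ 2 =
        ∑ k ∈ Finset.Ico 1 (n + 1), C (b (n + 1)) * (C ((b (k + 1) - b k) * ∏ j ∈ Finset.Ico (k + 1) (n + 1), b j) * q k ^ 2) :=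
      Finset.sum_congr rfl fun k hk => by
        rw [Finset.prod_Ico_succ_top (by have := (Finset.mem_Ico.1 hk).2; omega : k + 1 ≤ n + 1)]
        simp only [map_mul, map_sub]
        ring
    rw [show n + 1 + 1 = n + 2 from rfl, show n + 1 + 2 = n + 3 from rfl, turan_det_succ hrec n, ih, ha (n + 2), ha (n + 1), sub_self, C_0, zero_mul, add_zero,
      Finset.sum_Ico_succ_top h1, Finset.prod_Ico_succ_top h1, Finset.Ico_self, Finset.prod_empty, mul_one, mul_add, Finset.mul_sum, e2]
    simp only [map_mul, map_sub]
    ring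

/-- **Constant diagonal and constant couplings: `D_{n+1} = b_1^{n+1}`** (a constant polynomial). [Szegő (1.12.3); this file, §1136] -/
theorem turan_det_const {q : ℕ → ℝ[X]} {a b : ℕ → ℝ} (hq0 : q 0 = 1) (hq1 : q 1 = Polynomial.X - C (a 0))
    (hrec : ∀ n, q (n + 2) = (Polynomial.X - C (a (n + 1))) * q (n + 1) - C (b (n + 1)) * q n) (ha : ∀ n, a n = a 0) (hb : ∀ n, b (n + 1) = b 1) (n : ℕ) :
    q (n + 1) ^ 2 - q (n + 2) * q n = C (b 1 ^ (n + 1)) := by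
  induction n with
  | zero => rw [zero_add, turan_det_one hq0 hq1 hrec, ha 1, sub_self, C_0, zero_mul, add_zero, pow_one]
  | succ n ih =>
    rw [show n + 1 + 1 = n + 2 by ring, show n + 1 + 2 = n + 3 by ring, turan_det_succ hrec n, ih, ha (n + 2), ha (n + 1), hb (n + 1), hb n, sub_self, sub_self, C_0,
      zero_mul, zero_mul, add_zero, add_zero, ← map_mul]
    congr 1; ring

/-- **TURÁN'S INEQUALITY (constant diagonal, non-decreasing positive couplings), quantitative: `b_1 · (b_1⋯b_n) ≤ D_{n+1}(x) = q_{n+1}(x)² − q_{n+2}(x) q_n(x)` for every real `x`** — in particular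
`D_{n+1}(x) > 0`. [Turán 1950; Szegő 1948 §3; Skovgaard 1954; this file, §1136] -/
theorem turan_inequality_recurrence {q : ℕ → ℝ[X]} {a b : ℕ → ℝ} (hq0 : q 0 = 1) (hq1 : q 1 = Polynomial.X - C (a 0))
    (hrec : ∀ n, q (n + 2) = (Polynomial.X - C (a (n + 1))) * q (n + 1) - C (b (n + 1)) * q n) (ha : ∀ n, a n = a 0) (hb : ∀ j, 0 < b j)
    (hmono : ∀ n, 1 ≤ n → b n ≤ b (n + 1)) (n : ℕ) (x : ℝ) :
    b 1 * ∏ j ∈ Finset.Ico 1 (n + 1), b j ≤ (q (n + 1) ^ 2 - q (n + 2) * q n).eval x ∧ 0 < (q (n + 1) ^ 2 - q (n + 2) * q n).eval x := by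
  have hpos : ∀ m, 0 < b 1 * ∏ j ∈ Finset.Ico 1 (m + 1), b j := fun m => mul_pos (hb 1) (Finset.prod_pos fun j _ => hb j)
  suffices h : b 1 * ∏ j ∈ Finset.Ico 1 (n + 1), b j ≤ (q (n + 1) ^ 2 - q (n + 2) * q n).eval x from ⟨h, (hpos n).trans_le h⟩
  induction n with
  | zero => rw [zero_add, turan_det_one hq0 hq1 hrec, ha 1, sub_self, C_0, zero_mul, add_zero, eval_C, Finset.Ico_self, Finset.prod_empty, mul_one]
  | succ n ih =>
    rw [show n + 1 + 1 = n + 2 by ring, show n + 1 + 2 = n + 3 by ring, turan_det_succ hrec n, ha (n + 2), ha (n + 1), sub_self, C_0, zero_mul, add_zero, eval_add, eval_mul, eval_C,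
      eval_mul, eval_C, eval_pow, Finset.prod_Ico_succ_top (by omega : 1 ≤ n + 1)]
    have h1 : b 1 * ((∏ j ∈ Finset.Ico 1 (n + 1), b j) * b (n + 1)) = b (n + 1) * (b 1 * ∏ j ∈ Finset.Ico 1 (n + 1), b j) := by ring
    have h2 : 0 ≤ (b (n + 2) - b (n + 1)) * (q (n + 1)).eval x ^ 2 := mul_nonneg (sub_nonneg.2 (hmono (n + 1) (by omega))) (sq_nonneg _)
    rw [h1]
    nlinarith [mul_le_mul_of_nonneg_left ih (hb (n + 1)).le]

/-- **CHEBYSHEV CALIBRATION: `U_{n+1}² − U_{n+2} U_n = 1`** (constant recurrence `a ≡ 0`, `b ≡ 1∕4`: `D_{n+1} = 4^{−(n+1)}` for `q_n = 2^{−n} U_n`). [Szegő (1.12.3); this file, §1136] -/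
theorem chebyshevU_turan (n : ℕ) :
    Polynomial.Chebyshev.U ℝ ((n : ℤ) + 1) ^ 2 - Polynomial.Chebyshev.U ℝ ((n : ℤ) + 2) * Polynomial.Chebyshev.U ℝ (n : ℤ) = 1 := by
  obtain ⟨q, hq0, hq1, hrec⟩ := recurrence_of_coefficients (fun _ => (0 : ℝ)) (fun _ => (1 / 4 : ℝ))
  have hU := chebyshevU_recurrence_eq_U (a := fun _ => (0 : ℝ)) (b := fun _ => (1 / 4 : ℝ)) hq0 hq1 hrec (fun _ => rfl) (fun _ => rfl)
  have hD := turan_det_const (a := fun _ => (0 : ℝ)) (b := fun _ => (1 / 4 : ℝ)) hq0 hq1 hrec (fun _ => rfl) (fun _ => rfl) n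
  rw [hU (n + 1), hU (n + 2), hU n] at hD
  push_cast at hD
  have hc : C ((1 / 2 : ℝ) ^ (n + 1)) ^ 2 = C ((1 / 4 : ℝ) ^ (n + 1)) := by rw [← map_pow, ← pow_mul, pow_mul']; norm_num
  have hc' : C ((1 / 2 : ℝ) ^ (n + 2)) * C ((1 / 2 : ℝ) ^ n) = C ((1 / 4 : ℝ) ^ (n + 1)) := by
    rw [← map_mul, ← pow_add, show n + 2 + n = 2 * (n + 1) by ring, pow_mul]; norm_num
  have hne : C ((1 / 4 : ℝ) ^ (n + 1)) ≠ 0 := by rw [Ne, Polynomial.C_eq_zero]; positivity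
  have key : C ((1 / 4 : ℝ) ^ (n + 1)) * (Polynomial.Chebyshev.U ℝ ((n : ℤ) + 1) ^ 2 - Polynomial.Chebyshev.U ℝ ((n : ℤ) + 2) * Polynomial.Chebyshev.U ℝ (n : ℤ)) =
      C ((1 / 4 : ℝ) ^ (n + 1)) * 1 := by
    linear_combination hD - (Polynomial.Chebyshev.U ℝ ((n : ℤ) + 1) ^ 2) * hc + (Polynomial.Chebyshev.U ℝ ((n : ℤ) + 2) * Polynomial.Chebyshev.U ℝ (n : ℤ)) * hc'
  exact mul_left_cancel₀ hne key

/-- **HERMITE CALIBRATION (Turán–Szegő): `n! ≤ He_{n+1}(x)² − He_{n+2}(x) He_n(x)`** for Mathlib's probabilists' Hermite polynomials (`a ≡ 0`, `b_j = j` non-decreasing). [Szegő 1948 §3; this file,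
§1136] -/
theorem hermite_turan (n : ℕ) (x : ℝ) :
    ((Nat.factorial n : ℕ) : ℝ) ≤ (((Polynomial.hermite (n + 1)).map (Int.castRingHom ℝ)) ^ 2 -
      (Polynomial.hermite (n + 2)).map (Int.castRingHom ℝ) * (Polynomial.hermite n).map (Int.castRingHom ℝ)).eval x := by
  obtain ⟨b, hbdef⟩ : ∃ b : ℕ → ℝ, b = fun j => ((max j 1 : ℕ) : ℝ) := ⟨_, rfl⟩
  obtain ⟨h0, h1, hr⟩ := hermite_real_recurrence
  have hbsucc : ∀ m, b (m + 1) = (m : ℝ) + 1 := fun m => by rw [hbdef]; simp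
  have hrec : ∀ m, (Polynomial.hermite (m + 2)).map (Int.castRingHom ℝ) =
      (Polynomial.X - C (0 : ℝ)) * (Polynomial.hermite (m + 1)).map (Int.castRingHom ℝ) - C (b (m + 1)) * (Polynomial.hermite m).map (Int.castRingHom ℝ) := fun m => by
    rw [hbsucc]; exact hr m
  have hb : ∀ j, 0 < b j := fun j => by
    rw [hbdef]
    have h : 0 < max j 1 := lt_of_lt_of_le Nat.one_pos (le_max_right _ _)
    show (0 : ℝ) < ((max j 1 : ℕ) : ℝ)
    exact_mod_cast h
  have hmono : ∀ m, 1 ≤ m → b m ≤ b (m + 1) := fun m _ => by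
    rw [hbdef]
    show (((max m 1 : ℕ)) : ℝ) ≤ ((max (m + 1) 1 : ℕ) : ℝ)
    exact_mod_cast max_le_max (Nat.le_succ m) le_rfl
  have h := (turan_inequality_recurrence (q := fun m => (Polynomial.hermite m).map (Int.castRingHom ℝ)) (a := fun _ => (0 : ℝ)) h0 h1 hrec (fun _ => rfl) hb hmono n x).1
  have hprod : b 1 * ∏ j ∈ Finset.Ico 1 (n + 1), b j = ((Nat.factorial n : ℕ) : ℝ) := by
    rw [show b 1 = 1 by rw [← zero_add 1, hbsucc 0, Nat.cast_zero, zero_add], one_mul, ← Finset.prod_Ico_id_eq_factorial, Nat.cast_prod]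
    refine Finset.prod_congr rfl fun j hj => ?_
    rw [hbdef]
    show ((max j 1 : ℕ) : ℝ) = (j : ℝ)
    rw [max_eq_left (Finset.mem_Ico.1 hj).1]
  rw [hprod] at h
  exact h

end Summit.Ventures.HSemireg.Wedge.HankelOuter
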